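import Summits.CriticalPhenomena.PercolationContinuityZ3.Theorems.PercNearOneGluingNoHeavyLowerTailIncStarOneTargetSideGlue
import Summits.CriticalPhenomena.PercolationContinuityZ3.Theorems.PercNearOneGluingNoHeavyLowerTailIncStarIrreducible
import HarnessLib

/-!
# One-target sides of two-separations (root outside), V: the reduction step for minimal counterexamples

Support file for the Sahi programme (`--supports stmt-CriticalPhenomena-4575`, prover prim-sahi-p2 gen 24).  No definitions, no named
facts, no sorries; standard axioms.  Memo `run/shared/lean/prim/prim-sahi/FROM-prim-sahi-p2-gen24-ONE-TARGET-SIDE.md` §0 (COROLLARY M′).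

**`incStar_oneTargetSide_reduce`.**  In the strong induction on the number of vertices that organises the structure theory of minimal
counterexamples (`IncStarIrreducible.incStar_of_irreducible₂`, gen 23), a two-separator `{u, v}` NOT containing the root whose non-root
side contains EXACTLY ONE target strictly inside is reducible: THEOREM G′ (`IncStarOneTargetSide.incStar_nonneg_of_oneTargetSide`)
moves the target onto the separator — for the weight itself and for the weight with the pair `(u, v)` made sure —, after which the side
is markless and gen 11's blob reduction (`SahiBlobReduction.exists_blobReduce`) replaces it by a single pair; the three resulting stars
live on the proper vertex set `R ∪ {u, v}`, where the induction hypothesis (stated as in gen 23: the star inside every vertex set of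
smaller size, for every weight) applies.  So a minimal counterexample has at least two targets strictly inside the non-root side of
every such separation (COROLLARY M′ of the memo; the `irreducible₃` packaging is left to the next seat).
-/

noncomputable section

namespace Summit.CriticalPhenomena.PercolationContinuityZ3.Theorems

namespace IncStarOneTargetSide

open MeasureTheory Set Literature.Probability.Percolation Literature.Probability.LatticeModels
open Literature.Probability.Percolation.DecisionTree (ind)
open scoped Classical

variable {n : ℕ}

/-- **Reduction at a one-target side (COROLLARY M′, induction step).**  Let `R ∋ s` be a finite root side, `u ≠ v` outside `R` with no
positive pair from `R` to the outside of `R ∪ {u, v}`, the target `a` strictly outside `R ∪ {u, v}` and the targets `b, c ∈ R ∪ {u, v}`.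
If the increasing star holds inside every vertex set of size `< n` for every weight (induction hypothesis), then it holds at
`(a, b, c)`. [this work] -/
theorem incStar_oneTargetSide_reduce (w : Sym2 (Fin n) → unitInterval) (R : Finset (Fin n)) {s u v a b c : Fin n}
    (hs : s ∈ R) (hu : u ∉ R) (hv : v ∉ R) (huv : u ≠ v) (ha : a ∉ R) (hau : a ≠ u) (hav : a ≠ v)
    (hb : b ∈ R ∨ b = u ∨ b = v) (hc : c ∈ R ∨ c = u ∨ c = v)
    (hw : ∀ x ∈ R, ∀ z, z ∉ R → z ≠ u → z ≠ v → w s(x, z) = 0)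
    (IH : ∀ (w' : Sym2 (Fin n) → unitInterval) (S : Finset (Fin n)), S.card < n → ∀ {x t₁ t₂ t₃ : Fin n},
        x ∈ S → t₁ ∈ S → t₂ ∈ S → t₃ ∈ S →
        0 ≤ sahiE3 (prodBernoulli w') (openConnIn (↑S : Set (Fin n)) x t₁) (openConnIn (↑S : Set (Fin n)) x t₂)
          (openConnIn (↑S : Set (Fin n)) x t₃)) :
    0 ≤ sahiE3 (prodBernoulli w) (openConn s a) (openConn s b) (openConn s c) := by
  have hcardn : Fintype.card (Fin n) = n := Fintype.card_fin n
  -- the side `N = V ∖ (R ∪ {u, v})`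
  set N : Finset (Fin n) := Finset.univ.filter fun y => y ∉ R ∧ y ≠ u ∧ y ≠ v with hNdef
  have memN : ∀ {y : Fin n}, y ∈ N ↔ y ∉ R ∧ y ≠ u ∧ y ≠ v := fun {y} => by simp [hNdef]
  have haN : a ∈ N := memN.2 ⟨ha, hau, hav⟩
  have hsN : s ∉ N := fun h => (memN.1 h).1 hs
  have huN : u ∉ N := fun h => (memN.1 h).2.1 rfl
  have hvN : v ∉ N := fun h => (memN.1 h).2.2 rfl
  have inN : ∀ {t : Fin n}, (t ∈ R ∨ t = u ∨ t = v) → t ∉ N := by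
    rintro t (ht | rfl | rfl) htN
    · exact (memN.1 htN).1 ht
    · exact huN htN
    · exact hvN htN
  have hbN : b ∉ N := inN hb
  have hcN : c ∉ N := inN hc
  -- after moving the target onto the separator the side is a blob: reduce it and use the induction hypothesis
  have blob : ∀ (w₀ : Sym2 (Fin n) → unitInterval), (∀ x ∈ R, ∀ z, z ∉ R → z ≠ u → z ≠ v → w₀ s(x, z) = 0) →
      ∀ {t₁ t₂ t₃ : Fin n}, t₁ ∉ N → t₂ ∉ N → t₃ ∉ N →
      0 ≤ sahiE3 (prodBernoulli w₀) (openConn s t₁) (openConn s t₂) (openConn s t₃) := by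
    intro w₀ hw₀ t₁ t₂ t₃ h₁ h₂ h₃
    have hexit : ∀ x ∈ N, ∀ z, z ∉ N → z ≠ u → z ≠ v → w₀ s(x, z) = 0 := by
      intro x hx z hz hzu hzv
      have hx' := memN.1 hx
      have hzR : z ∈ R := by
        by_contra h; exact hz (memN.2 ⟨h, hzu, hzv⟩)
      rw [Sym2.eq_swap]; exact hw₀ z hzR x hx'.1 hx'.2.1 hx'.2.2
    obtain ⟨w', hw'B, -, -, hE⟩ := SahiBlobReduction.exists_blobReduce w₀ N huN hvN huv hexit
    rw [IncStarIrreducible.sahiE3_openConn_eq_of_sahiE_eq w₀ w' (fun T hT => hE s hsN 3 T fun i t ht => ?_)]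
    swap
    · rcases hT i t ht with rfl | rfl | rfl; exacts [h₁, h₂, h₃]
    set S : Finset (Fin n) := Finset.univ \ N with hSdef
    have memS : ∀ {p : Fin n}, p ∉ N → p ∈ S := fun hp => Finset.mem_sdiff.2 ⟨Finset.mem_univ _, hp⟩
    have hSexit : ∀ p ∈ (↑S : Set (Fin n)), ∀ q ∉ (↑S : Set (Fin n)), w' s(p, q) = 0 := by
      intro p _ q hq
      have hqN : q ∈ N := by
        by_contra h; exact hq (Finset.mem_coe.2 (memS h))
      rw [Sym2.eq_swap]; exact hw'B q hqN p
    rw [IncStarIrreducible.sahiE3_openConn_eq_openConnIn_of_no_exit w' (↑S) hSexit (Finset.mem_coe.2 (memS hsN))]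
    have hScard : S.card < n := by
      have : a ∉ S := fun h => (Finset.mem_sdiff.1 h).2 haN
      simpa [hcardn] using Finset.card_lt_univ_of_notMem this
    exact IH w' S hScard (memS hsN) (memS h₁) (memS h₂) (memS h₃)
  -- the weight with the pair `(u, v)` made sure still has no exit from `R`
  have hw₁ : ∀ x ∈ R, ∀ z, z ∉ R → z ≠ u → z ≠ v → Function.update w s(u, v) 1 s(x, z) = 0 := by
    intro x hx z hz hzu hzv
    have hne : s(x, z) ≠ s(u, v) := by
      rw [Ne, Sym2.eq_iff]
      rintro (⟨rfl, -⟩ | ⟨rfl, -⟩)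
      · exact hu hx
      · exact hv hx
    rw [Function.update_of_ne hne]; exact hw x hx z hz hzu hzv
  -- THEOREM G′
  have hbR : b ∈ (↑R : Set (Fin n)) ∨ b = u ∨ b = v := by
    rcases hb with h | h | h; exacts [Or.inl (Finset.mem_coe.2 h), Or.inr (Or.inl h), Or.inr (Or.inr h)]
  have hcR : c ∈ (↑R : Set (Fin n)) ∨ c = u ∨ c = v := by
    rcases hc with h | h | h; exacts [Or.inl (Finset.mem_coe.2 h), Or.inr (Or.inl h), Or.inr (Or.inr h)]
  exact incStar_nonneg_of_oneTargetSide w (↑R : Set (Fin n)) (Finset.mem_coe.2 hs) (fun h => hu (Finset.mem_coe.1 h))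
    (fun h => hv (Finset.mem_coe.1 h)) (fun h => ha (Finset.mem_coe.1 h)) hbR hcR
    (fun x hx z hz hzu hzv => hw x (Finset.mem_coe.1 hx) z (fun h => hz (Finset.mem_coe.2 h)) hzu hzv)
    (blob w hw (inN (Or.inr (Or.inl rfl))) hbN hcN) (blob w hw (inN (Or.inr (Or.inr rfl))) hbN hcN)
    (blob _ hw₁ (inN (Or.inr (Or.inl rfl))) hbN hcN)

end IncStarOneTargetSide

end Summit.CriticalPhenomena.PercolationContinuityZ3.Theorems
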